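import Mathlib

/-!
# Route `GreenTaoLevelTwo`, crux `MNTwo` (stmt-Parity-21276), line `birth`, stub `stub_mnVertical`:
# averaging over short progressions and pigeonholing (GT 2008b §10, proofs of Lemmas 23 and 24)

Tool for block V4 (= AIF §10, hypothesis `hInv` of `…MNTwoPropNineteenOfInverse`) of the
`stub_mnVertical` census (B. Green, T. Tao, *Quadratic uniformity of the Möbius function*, Ann.
Inst. Fourier 58 (2008) = arXiv:math/0606087, §10: "From the averaging identity
`∑_w f(w) = ∑_w 𝔼_{1 ≤ l ≤ L} f(w + tl)`, valid for any compactly supported `f : ℤ → ℂ`, … by the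
pigeonhole principle we can find `w` such that `|𝔼_{1≤l≤L} ψ(dw + dtl) e(φ(dw+dtl))| ≳ 1`"; the
same device is used twice, in `d` and in `w`, in the proof of Lemma 24).  Def-free, for `f : ℤ → ℂ`
vanishing outside `[a, b]` and the window `W = [a − |t|L, b + |t|L]`:

* `sum_shift_eq` — `∑_{w ∈ W} f(w + c) = ∑_{w ∈ [a,b]} f(w)` for `|c| ≤ |t| L`;
* `sum_eq_avg_progressions` — `L · ∑_{[a,b]} f = ∑_{l=1}^{L} ∑_{w ∈ W} f(w + tl)`;
* `exists_large_progression` — some `w ∈ W` has `L ‖∑_{[a,b]} f‖ ≤ #W · ‖∑_{l=1}^{L} f(w + tl)‖`.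

References: [GreenTao2008QuadraticMobius] arXiv:math/0606087 §10 (proof of Lemma 23; Lemma 24).
-/

open Finset

namespace Summit.Parity.GeneralizedHardyLittlewood.GreenTaoLevelTwoMNTwoProgressionAveraging

/-- A sum of a function vanishing outside `[a,b]` over any finite set containing `[a,b]` is the sum
over `[a,b]`. [folklore] -/
theorem sum_eq_sum_Icc_of_support {f : ℤ → ℂ} {a b : ℤ} (hf : ∀ w, w ∉ Icc a b → f w = 0)
    {S : Finset ℤ} (hS : Icc a b ⊆ S) : ∑ w ∈ S, f w = ∑ w ∈ Icc a b, f w :=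
  (sum_subset hS fun w _ hw => hf w hw).symm

/-- **Shift invariance on a window**: for `f` vanishing outside `[a,b]` and `|c| ≤ |t| L`,
`∑_{w ∈ [a−|t|L, b+|t|L]} f(w + c) = ∑_{w ∈ [a,b]} f(w)`. [folklore] -/
theorem sum_shift_eq {f : ℤ → ℂ} {a b : ℤ} (hf : ∀ w, w ∉ Icc a b → f w = 0) (t : ℤ) (L : ℕ)
    {c : ℤ} (hc : |c| ≤ |t| * L) :
    ∑ w ∈ Icc (a - |t| * L) (b + |t| * L), f (w + c) = ∑ w ∈ Icc a b, f w := by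
  have hinj : Set.InjOn (fun w : ℤ => w + c) ↑(Icc (a - |t| * L) (b + |t| * L)) :=
    fun x _ y _ hxy => by simpa using hxy
  rw [← sum_image (f := f) hinj]
  apply sum_eq_sum_Icc_of_support hf
  intro v hv
  rw [mem_image]
  refine ⟨v - c, ?_, by ring⟩
  rw [mem_Icc] at hv ⊢
  obtain ⟨hc1, hc2⟩ := abs_le.mp hc
  constructor <;> linarith [hv.1, hv.2]

/-- **Averaging identity**: `L · ∑_{[a,b]} f = ∑_{l=1}^{L} ∑_{w ∈ [a−|t|L, b+|t|L]} f(w + tl)`.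
[cite: GreenTao2008QuadraticMobius, §10 (proof of Lemma 23, "the averaging identity")] -/
theorem sum_eq_avg_progressions {f : ℤ → ℂ} {a b : ℤ} (hf : ∀ w, w ∉ Icc a b → f w = 0)
    (t : ℤ) (L : ℕ) :
    (L : ℂ) * ∑ w ∈ Icc a b, f w =
      ∑ l ∈ Icc (1 : ℕ) L, ∑ w ∈ Icc (a - |t| * L) (b + |t| * L), f (w + t * l) := by
  have h : ∀ l ∈ Icc (1 : ℕ) L,
      ∑ w ∈ Icc (a - |t| * L) (b + |t| * L), f (w + t * l) = ∑ w ∈ Icc a b, f w := by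
    intro l hl
    rw [mem_Icc] at hl
    apply sum_shift_eq hf t L
    rw [abs_mul, Nat.abs_cast]
    exact mul_le_mul_of_nonneg_left (by exact_mod_cast hl.2) (abs_nonneg _)
  rw [sum_congr rfl h, sum_const, Nat.card_Icc, nsmul_eq_mul]
  push_cast
  ring

/-- **Pigeonhole on the window**: some `w ∈ [a−|t|L, b+|t|L]` carries a progression sum with
`L ‖∑_{[a,b]} f‖ ≤ #[a−|t|L, b+|t|L] · ‖∑_{l=1}^{L} f(w + tl)‖` (for `a ≤ b`, so the window is
nonempty). [cite: GreenTao2008QuadraticMobius, §10 (proof of Lemma 23, "by the pigeonhole principle we can find w")] -/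
theorem exists_large_progression {f : ℤ → ℂ} {a b : ℤ} (hab : a ≤ b)
    (hf : ∀ w, w ∉ Icc a b → f w = 0) (t : ℤ) (L : ℕ) :
    ∃ w ∈ Icc (a - |t| * L) (b + |t| * L),
      (L : ℝ) * ‖∑ w ∈ Icc a b, f w‖ ≤
        (#(Icc (a - |t| * L) (b + |t| * L)) : ℝ) * ‖∑ l ∈ Icc (1 : ℕ) L, f (w + t * l)‖ := by
  set W := Icc (a - |t| * L) (b + |t| * L) with hW
  have hne : W.Nonempty := by
    refine ⟨a, ?_⟩
    rw [hW, mem_Icc]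
    have : 0 ≤ |t| * (L : ℤ) := by positivity
    constructor <;> linarith
  obtain ⟨w₀, hw₀, hmax⟩ :=
    exists_max_image W (fun w => ‖∑ l ∈ Icc (1 : ℕ) L, f (w + t * l)‖) hne
  refine ⟨w₀, hw₀, ?_⟩
  have havg := sum_eq_avg_progressions hf t L
  rw [sum_comm] at havg
  have hnorm : (L : ℝ) * ‖∑ w ∈ Icc a b, f w‖ = ‖∑ w ∈ W, ∑ l ∈ Icc (1 : ℕ) L, f (w + t * l)‖ := by
    rw [← havg, norm_mul, Complex.norm_natCast]
  rw [hnorm]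
  calc ‖∑ w ∈ W, ∑ l ∈ Icc (1 : ℕ) L, f (w + t * l)‖
      ≤ ∑ w ∈ W, ‖∑ l ∈ Icc (1 : ℕ) L, f (w + t * l)‖ := norm_sum_le _ _
    _ ≤ ∑ _w ∈ W, ‖∑ l ∈ Icc (1 : ℕ) L, f (w₀ + t * l)‖ := sum_le_sum fun w hw => hmax w hw
    _ = (#W : ℝ) * ‖∑ l ∈ Icc (1 : ℕ) L, f (w₀ + t * l)‖ := by
        rw [sum_const, nsmul_eq_mul]

end Summit.Parity.GeneralizedHardyLittlewood.GreenTaoLevelTwoMNTwoProgressionAveraging
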